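import Summits.FinalStateConjecture.FinalStateConjecture.Theses.ZeroEnergyKerrOrBomb

/-!
# `ZeroEnergyRigidity` (crux `stmt-FinalStateConjecture-10690`): the normalisation of the stationary field is free

Negative-lane load-bearing analysis (cdisprove seat, cycle 2).  The hypothesis structure
`StationaryAFBlackHole` asks of its stationary field `T = 𝓑.killing` only: Killing, complete,
future-directed timelike on `M_ext = ⋃ₜ φₜ(Σ_ext')`.  None of this fixes the normalisation of `T`
(`g(T,T) → −1` at infinity is not a field): `StationaryRescale.rescale 𝓑 hc` replaces `T` by
`c • T`, `c > 0`, and is again a `StationaryAFBlackHole` with the SAME spacetime, slice data, AF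
end, `M_ext` (`rescale_Mext`: orbits are reparametrised, `stationaryOrbit_const_smul`), d.o.c.
(`rescale_doc`) and future event horizon (`rescale_horizon`).  The two hypotheses of the crux that
mention `T` are invariant: h5 (`rescale_killing_ne_zero_iff`) and the zero-energy clause
`g(T, γ̇) = 0` of h6 (`rescale_zeroEnergy_iff`); h1–h4 and the conclusion do not mention `T` at all
(they see only the metric, `M_ext`, `doc`, `horizon`).  Hence no proof of the crux can extract a
normalisation of `T` from h1–h6, and any strengthening of the conclusion that identifies `T` with
`∂_{t*}` of the Kerr chart (`dΨ(e₀) = T`, numerical `Ω_H`, numerical `κ`) fails at `rescale 𝓑 2`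
whenever it holds at `𝓑`; such identifications must first normalise `T` through the asymptotic
decay of the slice data.

References: P. T. Chruściel, J. L. Costa, Astérisque 321 (2008), §2.1–2.2 ((2.1) `M_ext`,
(2.2) `⟨⟨M_ext⟩⟩`); B. O'Neill, *Semi-Riemannian geometry*, 1983, Ch. 9 (Killing fields form a
vector space; complete vector fields).
-/

noncomputable section

namespace Summit.FinalStateConjecture.FinalStateConjecture.Theorems.ZeroEnergyRigidity.Negative

open Literature.Geometry.Lorentzian
open scoped Manifold ContDiff

universe u

/-- **Orbits of `c • V` are the orbits of `V`** (`c ≠ 0`): the whole-line integral curves of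
`c • V` are the reparametrisations `γ ∘ (· * c)` of those of `V` (`IsMIntegralCurve.comp_mul`).
Chruściel–Costa 2008, (2.1). [cite: ChruscielCosta2008, §2.2 (2.1)] -/
theorem stationaryOrbit_const_smul {M : Type*} [TopologicalSpace M] [ChartedSpace E4 M]
    (V : Π x : M, TangentSpace (𝓡 4) x) {c : ℝ} (hc : c ≠ 0) (A : Set M) :
    stationaryOrbit (c • V) A = stationaryOrbit V A := by
  ext y
  constructor
  · rintro ⟨γ, hγ, h0, t, rfl⟩
    refine ⟨γ ∘ (· * c⁻¹), ?_, by simpa using h0, t * c, by simp [mul_assoc, mul_inv_cancel₀ hc]⟩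
    simpa [smul_smul, inv_mul_cancel₀ hc] using hγ.comp_mul c⁻¹
  · rintro ⟨γ, hγ, h0, t, rfl⟩
    exact ⟨γ ∘ (· * c), hγ.comp_mul c, by simpa using h0, t * c⁻¹,
      by simp [mul_assoc, inv_mul_cancel₀ hc]⟩

namespace StationaryRescale

/-- Constant multiples of Killing fields are Killing fields (`∇(c • K) = c • ∇K` by
`IsCovariantDerivativeOn.smul_const`; the Killing equation is linear). O'Neill 1983, Ch. 9,
Prop. 9.25. [cite: ONeill1983, Ch. 9, Prop. 9.25] -/
theorem isKillingField_const_smul (𝓑 : StationaryAFBlackHole.{u}) [𝓑.metric.HasLeviCivita]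
    {K : Π x : 𝓑.carrier, TangentSpace (𝓡 4) x}
    (hK : 𝓑.metric.IsKillingField K) (c : ℝ) : 𝓑.metric.IsKillingField (c • K) := by
  refine ⟨hK.contMDiff.const_smul_section, fun x Y₀ Z₀ ↦ ?_⟩
  have hKx : MDifferentiableAt (𝓡 4) (𝓡 4).tangent
      (fun y ↦ (⟨y, K y⟩ : TangentBundle (𝓡 4) 𝓑.carrier)) x :=
    (hK.contMDiff x).mdifferentiableAt (by simp)
  have hs : 𝓑.metric.leviCivita (c • K) x = c • 𝓑.metric.leviCivita K x :=
    𝓑.metric.leviCivita.isCovariantDerivativeOnUniv.smul_const c hKx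
  have h := hK.val_leviCivita_add x Y₀ Z₀
  simp only [hs, FunLike.coe_smul, Pi.smul_apply, map_smul, smul_eq_mul]
  linear_combination c * h

variable (𝓑 : StationaryAFBlackHole.{u}) {c : ℝ} (hc : 0 < c)

/-- **The stationary field may be rescaled.**  `𝓑` with `T` replaced by `c • T`, `c > 0`: the
same spacetime, slice, data, end, embedding and normal; `c • T` is Killing
(`isKillingField_const_smul`), complete (reparametrised integral curves), and future-directed
timelike on its `M_ext`, which is the old one (`stationaryOrbit_const_smul`). Chruściel–Costa
2008, §2.1 (the data `(M, g, X₀, Σ_ext)`). [cite: ChruscielCosta2008, §2.1] -/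
def rescale : StationaryAFBlackHole.{u} :=
  { 𝓑 with
    killing := c • 𝓑.killing
    isStationary := by
      intro _
      refine ⟨isKillingField_const_smul 𝓑 𝓑.isStationary.isKillingField c, fun x ↦ ?_,
        fun x hx ↦ ?_⟩
      · obtain ⟨γ, hγ, h0⟩ := 𝓑.isStationary.isCompleteVectorField x
        exact ⟨γ ∘ (· * c), hγ.comp_mul c, by simpa using h0⟩
      · rw [stationaryOrbit_const_smul _ hc.ne'] at hx
        obtain ⟨ht, hf⟩ := 𝓑.isStationary.isTimelike hx
        have ht' : 𝓑.metric.val x (c • 𝓑.killing x) (c • 𝓑.killing x) < 0 := by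
          have : 𝓑.metric.val x (c • 𝓑.killing x) (c • 𝓑.killing x) =
              c * c * 𝓑.metric.val x (𝓑.killing x) (𝓑.killing x) := by
            simp only [map_smul, FunLike.coe_smul, Pi.smul_apply, smul_eq_mul]; ring
          rw [this]
          exact mul_neg_of_pos_of_neg (mul_pos hc hc) ht
        refine ⟨ht', ⟨ht'.le, ?_⟩, ?_⟩
        · exact smul_ne_zero hc.ne' hf.1.2
        · have : 𝓑.metric.val x (𝓑.timeOrientation.vectorField x) (c • 𝓑.killing x) =
              c * 𝓑.metric.val x (𝓑.timeOrientation.vectorField x) (𝓑.killing x) := by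
            simp only [map_smul, smul_eq_mul]
          rw [Pi.smul_apply, this]
          exact mul_neg_of_pos_of_neg hc hf.2 }

/-- The spacetime of the rescaled structure is the old one (`rfl`). [folklore] -/
@[simp] theorem rescale_toSpacetime : (rescale 𝓑 hc).toSpacetime = 𝓑.toSpacetime := rfl

/-- The stationary field of the rescaled structure is `c • T` (`rfl`). [folklore] -/
@[simp] theorem rescale_killing : (rescale 𝓑 hc).killing = c • 𝓑.killing := rfl

/-- The metric is untouched, so the standing Levi-Civita hypothesis transfers. [folklore] -/
instance rescale_hasLeviCivita {𝓑 : StationaryAFBlackHole.{u}} {c : ℝ} {hc : 0 < c}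
    [h : 𝓑.metric.HasLeviCivita] : (rescale 𝓑 hc).metric.HasLeviCivita := h

/-- **Same `M_ext`.** Chruściel–Costa 2008, (2.1). [cite: ChruscielCosta2008, §2.2 (2.1)] -/
@[simp] theorem rescale_Mext : (rescale 𝓑 hc).Mext = 𝓑.Mext :=
  stationaryOrbit_const_smul _ hc.ne' _

/-- **Same domain of outer communications.** Chruściel–Costa 2008, (2.2). [cite: ChruscielCosta2008, §2.2 (2.2)] -/
@[simp] theorem rescale_doc : (rescale 𝓑 hc).doc = 𝓑.doc := by
  simp only [StationaryAFBlackHole.doc, rescale_Mext]; rfl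

/-- **Same future event horizon.** Chruściel–Costa 2008, (2.5). [cite: ChruscielCosta2008, §2.2 (2.5)] -/
@[simp] theorem rescale_horizon : (rescale 𝓑 hc).horizon = 𝓑.horizon := by
  simp only [StationaryAFBlackHole.horizon, rescale_Mext]; rfl

/-- **h5 of `ZeroEnergyRigidity` is invariant under rescaling** (`T ≠ 0` on the d.o.c.). [folklore] -/
theorem rescale_killing_ne_zero_iff :
    (∀ p ∈ (rescale 𝓑 hc).doc, (rescale 𝓑 hc).killing p ≠ 0) ↔ ∀ p ∈ 𝓑.doc, 𝓑.killing p ≠ 0 := by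
  simp only [rescale_doc, rescale_killing, Pi.smul_apply]
  exact forall₂_congr fun p _ ↦
    ⟨fun h h0 ↦ h (by rw [h0, smul_zero]; rfl), fun h ↦ smul_ne_zero hc.ne' h⟩

/-- **The zero-energy condition `g(T, v) = 0` of h6 is invariant under rescaling.** [folklore] -/
theorem rescale_zeroEnergy_iff (x : 𝓑.carrier) (v : TangentSpace (𝓡 4) x) :
    (rescale 𝓑 hc).metric.val x ((rescale 𝓑 hc).killing x) v = 0 ↔
      𝓑.metric.val x (𝓑.killing x) v = 0 := by
  change 𝓑.metric.val x (c • 𝓑.killing x) v = 0 ↔ _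
  simp only [map_smul, FunLike.coe_smul, Pi.smul_apply, smul_eq_mul, mul_eq_zero, hc.ne', false_or]

end StationaryRescale

end Summit.FinalStateConjecture.FinalStateConjecture.Theorems.ZeroEnergyRigidity.Negative
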